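import Mathlib
import HarnessLib
import Literature.MathematicalPhysics.QuantumLattice.SectorisedIncrementBoundGradedLipschitzPlateau
import Literature.MathematicalPhysics.QuantumLattice.SectorisedIncrementBoundGradedLipschitzPrescribedPlateau
import Summits.HubbardSuperconductivity.HubbardSuperconductivity.Theorems.KLProgrammeKLRegimeEngineTowerBlockStepLev

/-!
# Route `KLProgramme` — crux K3 ENGINE (stmt-HubbardSuperconductivity-20437 `KLRegimeEngineV17F2`), stub (e) rows C1/C2 «(e)-C ⇐ (b)-TWOVOL»:
# the two Hstep-Lip doors AT A BLOCK STEP of the scale flow, plateau and parent facts discharged — the polarised twin of E1's (I1) model half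
# `…EngineTowerBlockStep{Wt,Lev}` (cell gate-hubbard-kl, seat hubbard-kl-k3c5-p2 g9)

A block step of the blocked tower at the frame `K` integrates `Γ := C^K_{(Λ_{J₂}, Λ_{J₁}]} = hubbardCovSliceCT L M β μ 0 K (klScale klE0 J₂) (klScale klE0 J₁)`,
`1 ≤ J₁ ≤ J₂`; input family `F_{J₁−1} := klAnisoFamily … K klE0 (J₁−1)` with fat partner `F̃_{J₁−1} := bgmFatMultiplier … (J₁−1)`, output family `F_{J′}`,
`J₁ ≤ J′` (E1-LEVELS-BLUEPRINT §1 family convention).  For TWO even inputs `G, G′` without constant part (the two volumes' data on the common fine algebra after the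
transfer, or two cutoffs — ANY pair here) this file DISCHARGES the plateau hypotheses of my two-input doors (`Literature/…/SectorisedIncrementBoundGradedLipschitzPlateau`
p572336, `…GradedLipschitzPrescribedPlateau` p573833) at this geometry with E1's §1 facts (`sum_klAnisoFamily_eq_one_of_blockSliceCT_ne_zero`,
`sum_klAnisoFamily_pred_eq_one_of_klAnisoFamily_ne_zero`, `bgmFatMultiplier_mul_bgmMultiplier`, `klAnisoFamily_eq_zero_of_sum_eq_zero`) and, on the levels track,
E1's child relation (support overlap, `overlap_of_sectorAnalysis_mul_sectorSub_ne_zero`) and k3c2-p3's parents count `27` (`card_parentsLeg_klAniso_le`):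

* §1 **`blockStep_ordersGe2_plainLip_le`** — orders ≥ 2 of the DIFFERENCE of the two inputs' block-step increments, plain sectorised norm at `F_{J′}` (any constraint
  set), mixed graded RHS: common majorant `μ̄` of the inputs' `F_{J₁−1}`-sizes, difference profile `ν̄`, `+ 2·`tail; **`blockStep_firstOrder_plainLip_le`** — first
  order at the difference (binomial RHS in `G − G′`'s sizes);
* §2 **`blockStep_ordersGe2_levLip_le`** — the same on the LEVELLED (prescribed-legs) track: output legs `J` prescribed, pinned leg `p ∉ J`, COMMON coarse-family
  prescribed sizes `B̄μ` of `G`, `G′` and `B̄ν` of `G − G′`, parents constant `27`; **`blockStep_firstOrder_levLip_le`** — first order = E1's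
  `blockStep_firstOrder_lev_le` at the even input `G − G′` (linearity of `e^{Δ_Γ}`).
Block constants (`κ`, `α`, `(cr, cc)`, `ρ`, `θ̄ < 1` of the majorant) as named hypotheses, exactly those of E1's one-input files.  These are the `hstep` inputs of
`towerBornDiff_le_law₄` in MODEL currency before the dictionary (`…TowerDoorToKitLip` p581487, `…TowerKitUnitsLip` p581645).  Compositions of landed theorems;
nothing about the model is asserted beyond them; nothing asserts superconductivity.
-/

noncomputable section

namespace Summit.HubbardSuperconductivity.HubbardSuperconductivity.Theorems.EngineV8

set_option linter.dupNamespace false -- summit = problem name (single-conjunct summit), D-0017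

open Real Finset Literature.MathematicalPhysics.QuantumLattice Literature.Probability.LatticeModels GrassmannAlgebra
open Summit.HubbardSuperconductivity.HubbardSuperconductivity.Theorems.KLProgrammeLegKernels
open Summit.HubbardSuperconductivity.HubbardSuperconductivity.Theorems.KLRegimeSplit
open Summit.HubbardSuperconductivity.HubbardSuperconductivity.Theorems.KLRegimeWick
open Summit.HubbardSuperconductivity.HubbardSuperconductivity.Theorems.TwoPointAssembly

variable {L M : ℕ} [NeZero L] [NeZero M]

/-! ## §1 The plain track: two inputs at a block step -/

/-- **ORDERS ≥ 2 OF A BLOCK STEP FOR THE DIFFERENCE OF TWO INPUTS, plain sectorised norm (the graded Lipschitz door at the block geometry).**  `1 ≤ J₁ ≤ J₂`,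
`J₁ ≤ J′`; `G, G′` even without constant part; common majorant `μ̄ ≥ ε_x‖G‖_{F_{J₁−1},univ,·}, ε_x‖G′‖_{…}` and difference profile `ν̄ ≥ ε_x‖G − G′‖_{…}`; block constants
as hypotheses; every degree `m + 1`, every constraint set `A` at `F_{J′}`. -/
theorem blockStep_ordersGe2_plainLip_le {β : ℝ} (hβ : 0 < β) (μ : ℝ) (K : TrigPolyC4v) {J₁ J₂ J' : ℕ} (hJ₁ : 1 ≤ J₁) (hJ : J₁ ≤ J₂) (hJ' : J₁ ≤ J')
    (G G' : HubbardGrassmann L M) (hG : G ∈ evenPart ℂ (HubbardFieldIdx L M)) (hG' : G' ∈ evenPart ℂ (HubbardFieldIdx L M))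
    (hG0 : constPart ℂ G = 0) (hG'0 : constPart ℂ G' = 0)
    (μb νb : ℕ → ℝ) (hμb0 : ∀ m', 0 ≤ μb m') (hνb0 : ∀ m', 0 ≤ νb m')
    (hμb : ∀ m', imagTimeWeight β M * hubbardSectorKernelNorm L M β (klAnisoFamily L M β μ K klE0 (J₁ - 1))
      (univ : Finset (Fin (2 * m') → SectorLeg (sectorCount (J₁ - 1)))) G ≤ μb m')
    (hμb' : ∀ m', imagTimeWeight β M * hubbardSectorKernelNorm L M β (klAnisoFamily L M β μ K klE0 (J₁ - 1))
      (univ : Finset (Fin (2 * m') → SectorLeg (sectorCount (J₁ - 1)))) G' ≤ μb m')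
    (hνb : ∀ m', imagTimeWeight β M * hubbardSectorKernelNorm L M β (klAnisoFamily L M β μ K klE0 (J₁ - 1))
      (univ : Finset (Fin (2 * m') → SectorLeg (sectorCount (J₁ - 1)))) (G - G') ≤ νb m')
    {κ : ℝ} (hκ : 0 < κ)
    (hGB : IsGramBoundedR ((sectorSubMatrix L M β (bgmFatMultiplier L M klE0 β (nambuXiCT L μ K) (J₁ - 1))).transpose *
      hubbardCovSliceCT L M β μ 0 K (klScale klE0 J₂) (klScale klE0 J₁) *
        sectorSubMatrix L M β (bgmFatMultiplier L M klE0 β (nambuXiCT L μ K) (J₁ - 1))) κ)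
    {α : ℝ} (hα : 0 < α)
    (hrow : ∀ X, ∑ Y, ‖((sectorSubMatrix L M β (bgmFatMultiplier L M klE0 β (nambuXiCT L μ K) (J₁ - 1))).transpose *
        hubbardCovSliceCT L M β μ 0 K (klScale klE0 J₂) (klScale klE0 J₁) *
          sectorSubMatrix L M β (bgmFatMultiplier L M klE0 β (nambuXiCT L μ K) (J₁ - 1))) X Y‖ ≤ α)
    (hcol : ∀ Y, ∑ X, ‖((sectorSubMatrix L M β (bgmFatMultiplier L M klE0 β (nambuXiCT L μ K) (J₁ - 1))).transpose *
        hubbardCovSliceCT L M β μ 0 K (klScale klE0 J₂) (klScale klE0 J₁) *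
          sectorSubMatrix L M β (bgmFatMultiplier L M klE0 β (nambuXiCT L μ K) (J₁ - 1))) X Y‖ ≤ α)
    {ρ : ℝ} (hρ : 0 < ρ) (hθ : Real.exp 1 * α * normV (SpaceTimeIdx L M × SectorLeg (sectorCount (J₁ - 1))) κ ρ μb / κ ^ 2 < 1)
    {cr cc : ℝ} (hcr0 : 0 ≤ cr) (hcc0 : 0 ≤ cc)
    (hrow' : ∀ X'', ∑ X', ‖(sectorAnalysisMatrix L M β (klAnisoFamily L M β μ K klE0 J') *
        sectorSubMatrix L M β (bgmFatMultiplier L M klE0 β (nambuXiCT L μ K) (J₁ - 1))) X'' X'‖ ≤ cr)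
    (hcol' : ∀ X', ∑ X'', ‖(sectorAnalysisMatrix L M β (klAnisoFamily L M β μ K klE0 J') *
        sectorSubMatrix L M β (bgmFatMultiplier L M klE0 β (nambuXiCT L μ K) (J₁ - 1))) X'' X'‖ ≤ cc)
    {N₀ : ℕ} (hN₀ : 2 ≤ N₀) (m : ℕ) (A : Finset (Fin (m + 1) → SectorLeg (sectorCount J'))) :
    hubbardSectorKernelNorm L M β (klAnisoFamily L M β μ K klE0 J') A
        ((effAction ℂ (hubbardCovSliceCT L M β μ 0 K (klScale klE0 J₂) (klScale klE0 J₁)) G -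
            gaussConv ℂ (hubbardCovSliceCT L M β μ 0 K (klScale klE0 J₂) (klScale klE0 J₁)) G) -
          (effAction ℂ (hubbardCovSliceCT L M β μ 0 K (klScale klE0 J₂) (klScale klE0 J₁)) G' -
            gaussConv ℂ (hubbardCovSliceCT L M β μ 0 K (klScale klE0 J₂) (klScale klE0 J₁)) G')) ≤
      cr * cc ^ m * imagTimeWeight β M ^ m *
        (∑ n ∈ Ico 2 N₀, (ρ⁻¹ ^ (m + 1) * κ⁻¹ ^ (2 * (n - 1)) * (α ^ (n - 1) * Real.exp n)) *
            ∑ δ ∈ (Fintype.piFinset fun _ : Fin n => range (Fintype.card (SpaceTimeIdx L M × SectorLeg (sectorCount (J₁ - 1))) / 2 + 1)) with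
                m + 1 + 2 * (n - 1) ≤ ∑ a, 2 * δ a,
              ∑ a, (Real.exp 2 * (κ + ρ)) ^ (2 * δ a) * νb (δ a) *
                ∏ b ∈ univ.erase a, (Real.exp 2 * (κ + ρ)) ^ (2 * δ b) * μb (δ b) +
          2 * (ρ⁻¹ ^ (m + 1) * (Real.exp 1 * normV (SpaceTimeIdx L M × SectorLeg (sectorCount (J₁ - 1))) κ ρ μb) *
            (Real.exp 1 * α * normV (SpaceTimeIdx L M × SectorLeg (sectorCount (J₁ - 1))) κ ρ μb / κ ^ 2) ^ (N₀ - 1) /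
            (1 - Real.exp 1 * α * normV (SpaceTimeIdx L M × SectorLeg (sectorCount (J₁ - 1))) κ ρ μb / κ ^ 2))) := by
  classical
  have he : (0 : ℝ) < klE0 := by norm_num [klE0]
  exact hubbardSectorKernelNorm_effAction_sub_gaussConv_sub_le_graded_of_gramBounded_of_plateau hβ
    (klAnisoFamily L M β μ K klE0 (J₁ - 1)) (bgmFatMultiplier L M klE0 β (nambuXiCT L μ K) (J₁ - 1))
    (fun ω k => bgmFatMultiplier_mul_bgmMultiplier he β (nambuXiCT L μ K) (J₁ - 1) ω k)
    (fun k hk ω => klAnisoFamily_eq_zero_of_sum_eq_zero β μ K klE0 (J₁ - 1) k hk ω)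
    (klAnisoFamily L M β μ K klE0 J') G G' hG hG' hG0 hG'0 _
    (fun X Y hXY => sum_klAnisoFamily_eq_one_of_blockSliceCT_ne_zero β μ K hJ₁ hJ X Y hXY)
    (fun ω' k hne => sum_klAnisoFamily_pred_eq_one_of_klAnisoFamily_ne_zero β μ K hJ₁ hJ' ω' k hne)
    μb νb hμb0 hνb0 hμb hμb' hνb hκ hGB hα hrow hcol hρ hθ hcr0 hcc0 hrow' hcol' hN₀ m A

/-- **FIRST ORDER OF A BLOCK STEP FOR THE DIFFERENCE OF TWO INPUTS, plain sectorised norm** (`e^{Δ_Γ}` is linear: the binomial door at `G − G′`).  Even `G, G′`;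
Gram constant `κ ≥ 0`; every `p` and every constraint set `A` at `F_{J′}`. -/
theorem blockStep_firstOrder_plainLip_le {β : ℝ} (hβ : 0 < β) (μ : ℝ) (K : TrigPolyC4v) {J₁ J₂ J' : ℕ} (hJ₁ : 1 ≤ J₁) (hJ : J₁ ≤ J₂) (hJ' : J₁ ≤ J')
    (G G' : HubbardGrassmann L M) (hG : G ∈ evenPart ℂ (HubbardFieldIdx L M)) (hG' : G' ∈ evenPart ℂ (HubbardFieldIdx L M))
    {κ : ℝ} (hκ : 0 ≤ κ)
    (hGB : IsGramBoundedR ((sectorSubMatrix L M β (bgmFatMultiplier L M klE0 β (nambuXiCT L μ K) (J₁ - 1))).transpose *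
      hubbardCovSliceCT L M β μ 0 K (klScale klE0 J₂) (klScale klE0 J₁) *
        sectorSubMatrix L M β (bgmFatMultiplier L M klE0 β (nambuXiCT L μ K) (J₁ - 1))) κ)
    {cr cc : ℝ} (hcr0 : 0 ≤ cr) (hcc0 : 0 ≤ cc)
    (hrow' : ∀ X'', ∑ X', ‖(sectorAnalysisMatrix L M β (klAnisoFamily L M β μ K klE0 J') *
        sectorSubMatrix L M β (bgmFatMultiplier L M klE0 β (nambuXiCT L μ K) (J₁ - 1))) X'' X'‖ ≤ cr)
    (hcol' : ∀ X', ∑ X'', ‖(sectorAnalysisMatrix L M β (klAnisoFamily L M β μ K klE0 J') *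
        sectorSubMatrix L M β (bgmFatMultiplier L M klE0 β (nambuXiCT L μ K) (J₁ - 1))) X'' X'‖ ≤ cc)
    (p : ℕ) (A : Finset (Fin (2 * p + 1 + 1) → SectorLeg (sectorCount J'))) :
    hubbardSectorKernelNorm L M β (klAnisoFamily L M β μ K klE0 J') A
        ((gaussConv ℂ (hubbardCovSliceCT L M β μ 0 K (klScale klE0 J₂) (klScale klE0 J₁)) G - G) -
          (gaussConv ℂ (hubbardCovSliceCT L M β μ 0 K (klScale klE0 J₂) (klScale klE0 J₁)) G' - G')) ≤
      cr * cc ^ (2 * p + 1) * imagTimeWeight β M ^ (2 * p + 1) *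
        ∑ m' ∈ range (Fintype.card (SpaceTimeIdx L M × SectorLeg (sectorCount (J₁ - 1))) / 2 + 1),
          (if p + 1 < m' then ((2 * m').choose (2 * (p + 1)) : ℝ) * κ ^ (2 * m' - 2 * (p + 1)) *
            (imagTimeWeight β M * hubbardSectorKernelNorm L M β (klAnisoFamily L M β μ K klE0 (J₁ - 1))
              (univ : Finset (Fin (2 * m') → SectorLeg (sectorCount (J₁ - 1)))) (G - G')) else 0) := by
  classical
  have he : (0 : ℝ) < klE0 := by norm_num [klE0]
  exact hubbardSectorKernelNorm_gaussConv_sub_sub_le_binomial_of_gramBounded_of_plateau hβ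
    (klAnisoFamily L M β μ K klE0 (J₁ - 1)) (bgmFatMultiplier L M klE0 β (nambuXiCT L μ K) (J₁ - 1))
    (fun ω k => bgmFatMultiplier_mul_bgmMultiplier he β (nambuXiCT L μ K) (J₁ - 1) ω k)
    (fun k hk ω => klAnisoFamily_eq_zero_of_sum_eq_zero β μ K klE0 (J₁ - 1) k hk ω)
    (klAnisoFamily L M β μ K klE0 J') G G' hG hG' _
    (fun X Y hXY => sum_klAnisoFamily_eq_one_of_blockSliceCT_ne_zero β μ K hJ₁ hJ X Y hXY)
    (fun ω' k hne => sum_klAnisoFamily_pred_eq_one_of_klAnisoFamily_ne_zero β μ K hJ₁ hJ' ω' k hne)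
    hκ hGB hcr0 hcc0 hrow' hcol' p A

/-! ## §2 The levelled (prescribed-legs) track: two inputs at a block step -/

/-- **ORDERS ≥ 2 OF A BLOCK STEP FOR THE DIFFERENCE OF TWO INPUTS, PRESCRIBED LEGS (the graded prescribed Lipschitz door at the block geometry).**  `1 ≤ J₁ ≤ J₂`,
`J₁ ≤ J′`; child relation = support overlap of `F_{J′}` with `F̃_{J₁−1}` (parents count `27`); `G, G′` even without constant part; COMMON coarse-family prescribed sizes
`B̄μ m′ Fc` of `G` and `G′` at `F_{J₁−1}` and `B̄ν m′ Fc` of `G − G′`; block constants as hypotheses; output legs `J` prescribed to `τ″`, pinned leg `p ∉ J`. -/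
theorem blockStep_ordersGe2_levLip_le {β : ℝ} (hβ : 0 < β) (μ : ℝ) (K : TrigPolyC4v) {J₁ J₂ J' : ℕ} (hJ₁ : 1 ≤ J₁) (hJ : J₁ ≤ J₂) (hJ' : J₁ ≤ J')
    (G G' : HubbardGrassmann L M) (hG : G ∈ evenPart ℂ (HubbardFieldIdx L M)) (hG' : G' ∈ evenPart ℂ (HubbardFieldIdx L M))
    (hG0 : constPart ℂ G = 0) (hG'0 : constPart ℂ G' = 0)
    {κ : ℝ} (hκ : 0 < κ)
    (hGB : IsGramBoundedR ((sectorSubMatrix L M β (bgmFatMultiplier L M klE0 β (nambuXiCT L μ K) (J₁ - 1))).transpose *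
      hubbardCovSliceCT L M β μ 0 K (klScale klE0 J₂) (klScale klE0 J₁) *
        sectorSubMatrix L M β (bgmFatMultiplier L M klE0 β (nambuXiCT L μ K) (J₁ - 1))) κ)
    (Bμ Bν : ℕ → ℕ → ℝ) (hBμ0 : ∀ m' Fc, 0 ≤ Bμ m' Fc) (hBν0 : ∀ m' Fc, 0 ≤ Bν m' Fc)
    (hBμ : ∀ (m' Fc : ℕ) (E : Finset (Fin (2 * m' + 1 + 1))) (τ : Fin (2 * m' + 1 + 1) → SectorLeg (sectorCount (J₁ - 1)))
      (q : Fin (2 * m' + 1 + 1)), q ∈ E → E.card = Fc + 1 → ∀ y : SpaceTimeIdx L M,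
        imagTimeWeight β M ^ (2 * m' + 1) *
          ∑ σ ∈ univ.filter (fun σ : Fin (2 * m' + 1 + 1) → SectorLeg (sectorCount (J₁ - 1)) => ∀ e ∈ E, σ e = τ e),
            ∑ x ∈ univ.filter (fun x : Fin (2 * m' + 1 + 1) → SpaceTimeIdx L M => x q = y),
              ‖sectorisedKernel L M β (klAnisoFamily L M β μ K klE0 (J₁ - 1)) G (2 * m' + 1 + 1) σ x‖ ≤ Bμ (m' + 1) Fc)
    (hBμ' : ∀ (m' Fc : ℕ) (E : Finset (Fin (2 * m' + 1 + 1))) (τ : Fin (2 * m' + 1 + 1) → SectorLeg (sectorCount (J₁ - 1)))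
      (q : Fin (2 * m' + 1 + 1)), q ∈ E → E.card = Fc + 1 → ∀ y : SpaceTimeIdx L M,
        imagTimeWeight β M ^ (2 * m' + 1) *
          ∑ σ ∈ univ.filter (fun σ : Fin (2 * m' + 1 + 1) → SectorLeg (sectorCount (J₁ - 1)) => ∀ e ∈ E, σ e = τ e),
            ∑ x ∈ univ.filter (fun x : Fin (2 * m' + 1 + 1) → SpaceTimeIdx L M => x q = y),
              ‖sectorisedKernel L M β (klAnisoFamily L M β μ K klE0 (J₁ - 1)) G' (2 * m' + 1 + 1) σ x‖ ≤ Bμ (m' + 1) Fc)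
    (hBν : ∀ (m' Fc : ℕ) (E : Finset (Fin (2 * m' + 1 + 1))) (τ : Fin (2 * m' + 1 + 1) → SectorLeg (sectorCount (J₁ - 1)))
      (q : Fin (2 * m' + 1 + 1)), q ∈ E → E.card = Fc + 1 → ∀ y : SpaceTimeIdx L M,
        imagTimeWeight β M ^ (2 * m' + 1) *
          ∑ σ ∈ univ.filter (fun σ : Fin (2 * m' + 1 + 1) → SectorLeg (sectorCount (J₁ - 1)) => ∀ e ∈ E, σ e = τ e),
            ∑ x ∈ univ.filter (fun x : Fin (2 * m' + 1 + 1) → SpaceTimeIdx L M => x q = y),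
              ‖sectorisedKernel L M β (klAnisoFamily L M β μ K klE0 (J₁ - 1)) (G - G') (2 * m' + 1 + 1) σ x‖ ≤ Bν (m' + 1) Fc)
    {α : ℝ} (hα : 0 < α)
    (hrow : ∀ X, ∑ Y, ‖((sectorSubMatrix L M β (bgmFatMultiplier L M klE0 β (nambuXiCT L μ K) (J₁ - 1))).transpose *
        hubbardCovSliceCT L M β μ 0 K (klScale klE0 J₂) (klScale klE0 J₁) *
          sectorSubMatrix L M β (bgmFatMultiplier L M klE0 β (nambuXiCT L μ K) (J₁ - 1))) X Y‖ ≤ α)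
    (hcol : ∀ Y, ∑ X, ‖((sectorSubMatrix L M β (bgmFatMultiplier L M klE0 β (nambuXiCT L μ K) (J₁ - 1))).transpose *
        hubbardCovSliceCT L M β μ 0 K (klScale klE0 J₂) (klScale klE0 J₁) *
          sectorSubMatrix L M β (bgmFatMultiplier L M klE0 β (nambuXiCT L μ K) (J₁ - 1))) X Y‖ ≤ α)
    {ρ : ℝ} (hρ : 0 < ρ)
    (hθ : Real.exp 1 * α * normV (SpaceTimeIdx L M × SectorLeg (sectorCount (J₁ - 1))) κ ρ
      (fun m' => (27 : ℝ) ^ 0 * (imagTimeWeight β M * Bμ m' 0)) / κ ^ 2 < 1)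
    {cr cc : ℝ} (hcc0 : 0 ≤ cc)
    (hrow' : ∀ X'', ∑ X', ‖(sectorAnalysisMatrix L M β (klAnisoFamily L M β μ K klE0 J') *
        sectorSubMatrix L M β (bgmFatMultiplier L M klE0 β (nambuXiCT L μ K) (J₁ - 1))) X'' X'‖ ≤ cr)
    (hcol' : ∀ X', ∑ X'', ‖(sectorAnalysisMatrix L M β (klAnisoFamily L M β μ K klE0 J') *
        sectorSubMatrix L M β (bgmFatMultiplier L M klE0 β (nambuXiCT L μ K) (J₁ - 1))) X'' X'‖ ≤ cc)
    {N₀ : ℕ} (hN₀ : 2 ≤ N₀) {m : ℕ} (p : Fin (m + 1)) (J : Finset (Fin (m + 1))) (hp : p ∉ J)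
    (τ'' : Fin (m + 1) → SectorLeg (sectorCount J')) (w'' : SpaceTimeIdx L M × SectorLeg (sectorCount J')) :
    ∑ X'' ∈ univ.filter (fun X'' : Fin (m + 1) → SpaceTimeIdx L M × SectorLeg (sectorCount J') => X'' p = w'' ∧ ∀ j ∈ J, (X'' j).2 = τ'' j),
        ‖kernel ℂ (ExteriorAlgebra.map (Matrix.toLin' (sectorAnalysisMatrix L M β (klAnisoFamily L M β μ K klE0 J')))
          ((effAction ℂ (hubbardCovSliceCT L M β μ 0 K (klScale klE0 J₂) (klScale klE0 J₁)) G -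
              gaussConv ℂ (hubbardCovSliceCT L M β μ 0 K (klScale klE0 J₂) (klScale klE0 J₁)) G) -
            (effAction ℂ (hubbardCovSliceCT L M β μ 0 K (klScale klE0 J₂) (klScale klE0 J₁)) G' -
              gaussConv ℂ (hubbardCovSliceCT L M β μ 0 K (klScale klE0 J₂) (klScale klE0 J₁)) G'))) (m + 1) X''‖ ≤
      cr * cc ^ m *
        (∑ n ∈ Ico 2 N₀, (κ⁻¹ ^ (m + 1) * κ⁻¹ ^ (2 * (n - 1)) * (α ^ (n - 1) * Real.exp n)) *
            ∑ δ ∈ (Fintype.piFinset fun _ : Fin n => range (Fintype.card (SpaceTimeIdx L M × SectorLeg (sectorCount (J₁ - 1))) / 2 + 1)) with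
                m + 1 + 2 * (n - 1) ≤ ∑ a, 2 * δ a,
              ∑ pf : J → Fin n, ((∏ j, ((2 * δ (pf j) : ℕ) : ℝ)) / ((∑ a, 2 * δ a : ℕ) : ℝ) ^ J.card) *
                ∑ a, (Real.exp 3 * κ) ^ (2 * δ a) *
                    ((27 : ℝ) ^ (univ.filter fun j : J => pf j = a).card *
                      (imagTimeWeight β M * Bν (δ a) (univ.filter fun j : J => pf j = a).card)) *
                  ∏ b ∈ univ.erase a, (Real.exp 3 * κ) ^ (2 * δ b) *
                    ((27 : ℝ) ^ (univ.filter fun j : J => pf j = b).card *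
                      (imagTimeWeight β M * Bμ (δ b) (univ.filter fun j : J => pf j = b).card)) +
          2 * (ρ⁻¹ ^ (m + 1) *
              (Real.exp 1 * normV (SpaceTimeIdx L M × SectorLeg (sectorCount (J₁ - 1))) κ ρ
                (fun m' => (27 : ℝ) ^ 0 * (imagTimeWeight β M * Bμ m' 0))) *
            (Real.exp 1 * α * normV (SpaceTimeIdx L M × SectorLeg (sectorCount (J₁ - 1))) κ ρ
                (fun m' => (27 : ℝ) ^ 0 * (imagTimeWeight β M * Bμ m' 0)) / κ ^ 2) ^ (N₀ - 1) /
            (1 - Real.exp 1 * α * normV (SpaceTimeIdx L M × SectorLeg (sectorCount (J₁ - 1))) κ ρ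
                (fun m' => (27 : ℝ) ^ 0 * (imagTimeWeight β M * Bμ m' 0)) / κ ^ 2))) := by
  classical
  have he : (0 : ℝ) < klE0 := by norm_num [klE0]
  have hkJ : J₁ - 1 ≤ J' := by omega
  exact sum_filter_norm_sectorAnalysis_effAction_sub_gaussConv_sub_le_graded_prescribed_of_plateau hβ
    (klAnisoFamily L M β μ K klE0 (J₁ - 1)) (bgmFatMultiplier L M klE0 β (nambuXiCT L μ K) (J₁ - 1))
    (fun ω k => bgmFatMultiplier_mul_bgmMultiplier he β (nambuXiCT L μ K) (J₁ - 1) ω k)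
    (fun k hk ω => klAnisoFamily_eq_zero_of_sum_eq_zero β μ K klE0 (J₁ - 1) k hk ω)
    (klAnisoFamily L M β μ K klE0 J') G G' hG hG' hG0 hG'0 _
    (fun X Y hXY => sum_klAnisoFamily_eq_one_of_blockSliceCT_ne_zero β μ K hJ₁ hJ X Y hXY)
    (fun ω' k hne => sum_klAnisoFamily_pred_eq_one_of_klAnisoFamily_ne_zero β μ K hJ₁ hJ' ω' k hne)
    (fun ω'' ω' => ∃ q : FreqMomentum L M, klAnisoFamily L M β μ K klE0 J' ω'' q ≠ 0 ∧
      bgmFatMultiplier L M klE0 β (nambuXiCT L μ K) (J₁ - 1) ω' q ≠ 0)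
    (fun X'' X' hne => overlap_of_sectorAnalysis_mul_sectorSub_ne_zero β _ _ X'' X' hne)
    (by norm_num) (fun ℓ'' => by convert card_parentsLeg_klAniso_le β μ K hkJ ℓ'' using 3)
    hκ hGB Bμ Bν hBμ0 hBν0 hBμ hBμ' hBν hα hrow hcol hρ hθ hcc0 hrow' hcol' hN₀ p J hp τ'' w''

/-- **FIRST ORDER OF A BLOCK STEP FOR THE DIFFERENCE OF TWO INPUTS, PRESCRIBED LEGS**: `e^{Δ_Γ}` is linear, so this is E1's `blockStep_firstOrder_lev_le` at the even
input `G − G′` (prescribed sizes `B̄ν` of `G − G′`). -/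
theorem blockStep_firstOrder_levLip_le {β : ℝ} (hβ : 0 < β) (μ : ℝ) (K : TrigPolyC4v) {J₁ J₂ J' : ℕ} (hJ₁ : 1 ≤ J₁) (hJ : J₁ ≤ J₂) (hJ' : J₁ ≤ J')
    (G G' : HubbardGrassmann L M) (hG : G ∈ evenPart ℂ (HubbardFieldIdx L M)) (hG' : G' ∈ evenPart ℂ (HubbardFieldIdx L M))
    {κ : ℝ} (hκ : 0 ≤ κ)
    (hGB : IsGramBoundedR ((sectorSubMatrix L M β (bgmFatMultiplier L M klE0 β (nambuXiCT L μ K) (J₁ - 1))).transpose *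
      hubbardCovSliceCT L M β μ 0 K (klScale klE0 J₂) (klScale klE0 J₁) *
        sectorSubMatrix L M β (bgmFatMultiplier L M klE0 β (nambuXiCT L μ K) (J₁ - 1))) κ)
    (Bν : ℕ → ℕ → ℝ) (hBν0 : ∀ m' Fc, 0 ≤ Bν m' Fc)
    (hBν : ∀ (m' Fc : ℕ) (E : Finset (Fin (2 * m' + 1 + 1))) (τ : Fin (2 * m' + 1 + 1) → SectorLeg (sectorCount (J₁ - 1)))
      (q : Fin (2 * m' + 1 + 1)), q ∈ E → E.card = Fc + 1 → ∀ y : SpaceTimeIdx L M,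
        imagTimeWeight β M ^ (2 * m' + 1) *
          ∑ σ ∈ univ.filter (fun σ : Fin (2 * m' + 1 + 1) → SectorLeg (sectorCount (J₁ - 1)) => ∀ e ∈ E, σ e = τ e),
            ∑ x ∈ univ.filter (fun x : Fin (2 * m' + 1 + 1) → SpaceTimeIdx L M => x q = y),
              ‖sectorisedKernel L M β (klAnisoFamily L M β μ K klE0 (J₁ - 1)) (G - G') (2 * m' + 1 + 1) σ x‖ ≤ Bν (m' + 1) Fc)
    {cr cc : ℝ} (hcc0 : 0 ≤ cc)
    (hrow' : ∀ X'', ∑ X', ‖(sectorAnalysisMatrix L M β (klAnisoFamily L M β μ K klE0 J') *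
        sectorSubMatrix L M β (bgmFatMultiplier L M klE0 β (nambuXiCT L μ K) (J₁ - 1))) X'' X'‖ ≤ cr)
    (hcol' : ∀ X', ∑ X'', ‖(sectorAnalysisMatrix L M β (klAnisoFamily L M β μ K klE0 J') *
        sectorSubMatrix L M β (bgmFatMultiplier L M klE0 β (nambuXiCT L μ K) (J₁ - 1))) X'' X'‖ ≤ cc)
    {q : ℕ} (i : Fin (2 * q + 1 + 1)) (J : Finset (Fin (2 * q + 1 + 1))) (hi : i ∉ J)
    (τ'' : Fin (2 * q + 1 + 1) → SectorLeg (sectorCount J')) (w'' : SpaceTimeIdx L M × SectorLeg (sectorCount J')) :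
    ∑ X'' ∈ univ.filter (fun X'' : Fin (2 * q + 1 + 1) → SpaceTimeIdx L M × SectorLeg (sectorCount J') =>
        X'' i = w'' ∧ ∀ j ∈ J, (X'' j).2 = τ'' j),
        ‖kernel ℂ (ExteriorAlgebra.map (Matrix.toLin' (sectorAnalysisMatrix L M β (klAnisoFamily L M β μ K klE0 J')))
          ((gaussConv ℂ (hubbardCovSliceCT L M β μ 0 K (klScale klE0 J₂) (klScale klE0 J₁)) G - G) -
            (gaussConv ℂ (hubbardCovSliceCT L M β μ 0 K (klScale klE0 J₂) (klScale klE0 J₁)) G' - G'))) (2 * q + 1 + 1) X''‖ ≤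
      cr * cc ^ (2 * q + 1) *
        ∑ m' ∈ range (Fintype.card (SpaceTimeIdx L M × SectorLeg (sectorCount (J₁ - 1))) / 2 + 1), (if q + 1 < m' then
          ((((2 * (q + 1)).factorial : ℝ))⁻¹ * ((∏ j ∈ univ.filter (fun j : Fin (2 * (q + 1)) => j ∉ J), (2 * m' - (j : ℕ)) : ℕ) : ℝ)) *
            ((2 * m' : ℕ) : ℝ) ^ J.card * κ ^ (2 * m' - 2 * (q + 1)) * ((27 : ℝ) ^ J.card * (imagTimeWeight β M * Bν m' J.card)) else 0) := by
  have hlin : (gaussConv ℂ (hubbardCovSliceCT L M β μ 0 K (klScale klE0 J₂) (klScale klE0 J₁)) G - G) -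
      (gaussConv ℂ (hubbardCovSliceCT L M β μ 0 K (klScale klE0 J₂) (klScale klE0 J₁)) G' - G') =
      gaussConv ℂ (hubbardCovSliceCT L M β μ 0 K (klScale klE0 J₂) (klScale klE0 J₁)) (G - G') - (G - G') := by
    rw [map_sub]; abel
  rw [hlin]
  exact blockStep_firstOrder_lev_le hβ μ K hJ₁ hJ hJ' (G - G') (sub_mem hG hG') hκ hGB Bν hBν0 hBν hcc0 hrow' hcol' i J hi τ'' w''

end Summit.HubbardSuperconductivity.HubbardSuperconductivity.Theorems.EngineV8

end
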